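import Summits.QuantumFields.YangMills.Theorems.BalabanUVNodesN15KingModelReflectionPositivityCharFun

/-!
# BalabanUVNodes ∕ N15 — THE KING-MODEL RUNG (PART Ϻ-hh): THE INFRARED ∕ LARGE-MASS LIMIT — `S₂^{ℝ}_{m²}(z) ≤ m⁻² → 0`, all covariances, exponential moments and characteristic functionals of
# `μ_{∞,m²}` tend to those of the ZERO FIELD as `m² → ∞`: `μ_{∞,m²} ⇒ δ_0` (the trivial high-temperature fixed point towards which the block-spin flow `m ↦ Lm` of parts Ϻ-cc∕dd drives every
# massive King field) (Track A, DAG node N15 = NE2; FAN-OUT v1.1 §N15 s3 «KING-MODEL RUNG»; count-neutral)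

HONEST FRAMING.  Count-neutral (cell `pub-ymgap`, seat `pub-ymgap-dag-n15-e` g35; `--supports stmt-QuantumFields-27366 --as helper` = K3⁸).  King's `A = 0`, `g = 0` model
([King1986] C. King, Commun. Math. Phys. **102** (1986) 649–677).  The block-spin RG multiplies the mass by `L` at each step (parts Ϻ-cc∕dd), so the fate of every massive field is the
large-mass limit.  Typed: ★ `S₂^{ℝ}_{m²}(z) → 0` as `m² → ∞` (`0 < S₂^{ℝ} ≤ m⁻²`, part Ϻ-b); ★ `∫φ(z)φ(w)dμ_{∞,m²} → 0`; ★★ `∫e^{Σc_jφ(z_j)}dμ_{∞,m²} → 1` and ★★★ the LÉVY form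
`∫e^{iΣc_jφ(z_j)}dμ_{∞,m²} → 1 = ∫e^{iΣc_jφ(z_j)}dδ_0` — every finite-dimensional marginal converges weakly to the point mass at the zero field; in RG language (with part Ϻ-dd)
★★ `∫e^{iφ(f)}dμ_{∞,(L^n)²m²} → 1` as `n → ∞` for `L ≥ 2`: the iterated block-spin images of a massive King field converge to the trivial fixed point.  NOT Bałaban's objects; NOT a node discharge;
nothing continuum-Yang–Mills ∕ `ℝ⁴` ∕ OS ∕ Clay.  0 `sorry`, 0 def; standard axioms.

WHAT THIS FILE PROVES (kernel).  ★ `tendsto_kingS2Inf_mass_atTop`, `tendsto_quadForm_mass_atTop`, ★ `tendsto_covariance_mass_atTop_kingFieldInf`, ★★ `tendsto_integral_exp_fieldSum_mass_atTop`,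
★★★ **`tendsto_charFun_mass_atTop_kingFieldInf`**, `tendsto_pow_mul_atTop`, ★★ **`tendsto_charFun_blockSpin_iterates`**.

HONEST SCOPE.  King's free block fields at infinite volume; statements about the mass parameter only (the identification `(R_L^n)_*μ_{∞,m²} = μ_{∞,L^{2n}m²}` is part Ϻ-dd).  N15 untouched; counts unmoved.
Locators (use): [King1986] Thm 2.1 (2.22)–(2.23) p.654, §2 (2.3)–(2.6) p.652.
-/

noncomputable section

open scoped BigOperators Topology
open Filter MeasureTheory ProbabilityTheory Finset Complex

namespace Summit.QuantumFields.YangMills.BalabanUVNodes.N15KingModelRung.InfiniteVolume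

open Summit.QuantumFields.YangMills.BalabanUVNodes.N15KingModelRung.OptimalDecay
open Summit.QuantumFields.YangMills.BalabanUVNodes.N15KingModelRung.ProperTime

variable {d : ℕ} {J : Type*}

/-- ★ **`S₂^{ℝ}_{m²}(z) → 0` as `m² → ∞`** (`0 < S₂^{ℝ}_{m²}(z) ≤ m⁻²`). [cite: King1986, Thm 2.1 (2.23) p.654] -/
theorem tendsto_kingS2Inf_mass_atTop (z : Fin (d + 1) → ℤ) : Tendsto (fun m2 : ℝ => kingS2Inf m2 z) atTop (𝓝 0) := by
  refine tendsto_of_tendsto_of_tendsto_of_le_of_le' tendsto_const_nhds tendsto_inv_atTop_zero ?_ ?_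
  · filter_upwards [eventually_gt_atTop (0 : ℝ)] with m2 hm2 using (kingS2Inf_pos hm2 z).le
  · filter_upwards [eventually_gt_atTop (0 : ℝ)] with m2 hm2 using (kingS2Inf_pos_le hm2 z).2

/-- Every covariance quadratic form tends to `0` as `m² → ∞`. [folklore] -/
theorem tendsto_quadForm_mass_atTop (T : Finset J) (p : J → Fin (d + 1) → ℤ) (c : J → ℝ) :
    Tendsto (fun m2 : ℝ => ∑ j ∈ T, ∑ j' ∈ T, c j * c j' * kingS2Inf m2 (p j' - p j)) atTop (𝓝 0) := by
  have h0 : (0 : ℝ) = ∑ j ∈ T, ∑ j' ∈ T, c j * c j' * 0 := by simp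
  rw [h0]
  exact tendsto_finsetSum _ fun j _ => tendsto_finsetSum _ fun j' _ => (tendsto_kingS2Inf_mass_atTop _).const_mul _

/-- ★ The covariances of `μ_{∞,m²}` vanish in the large-mass limit: `∫φ(z)φ(w)dμ_{∞,m²} → 0`. [folklore] -/
theorem tendsto_covariance_mass_atTop_kingFieldInf (z w : Fin (d + 1) → ℤ) :
    Tendsto (fun m2 : ℝ => ∫ ω, ω z * ω w ∂kingFieldInf m2) atTop (𝓝 0) := by
  have hev : (fun m2 : ℝ => kingS2Inf m2 (w - z)) =ᶠ[atTop] fun m2 : ℝ => ∫ ω, ω z * ω w ∂kingFieldInf m2 := by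
    filter_upwards [eventually_gt_atTop (0 : ℝ)] with m2 hm2 using (integral_eval_mul_eval_kingFieldInf hm2 z w).symm
  exact (tendsto_kingS2Inf_mass_atTop _).congr' hev

/-- ★★ Exponential moments tend to `1`: `∫e^{Σc_jφ(p_j)}dμ_{∞,m²} → 1` as `m² → ∞`. [folklore] -/
theorem tendsto_integral_exp_fieldSum_mass_atTop (T : Finset J) (p : J → Fin (d + 1) → ℤ) (c : J → ℝ) :
    Tendsto (fun m2 : ℝ => ∫ ω, Real.exp (∑ j ∈ T, c j * ω (p j)) ∂kingFieldInf m2) atTop (𝓝 1) := by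
  have hev : (fun m2 : ℝ => Real.exp ((∑ j ∈ T, ∑ j' ∈ T, c j * c j' * kingS2Inf m2 (p j' - p j)) / 2))
      =ᶠ[atTop] fun m2 : ℝ => ∫ ω, Real.exp (∑ j ∈ T, c j * ω (p j)) ∂kingFieldInf m2 := by
    filter_upwards [eventually_gt_atTop (0 : ℝ)] with m2 hm2 using (integral_exp_fieldSum hm2 T p c).symm
  refine Tendsto.congr' hev ?_
  have h := ((Real.continuous_exp.tendsto _).comp ((tendsto_quadForm_mass_atTop T p c).div_const 2))
  rwa [zero_div, Function.comp_def, Real.exp_zero] at h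

/-- ★★★ **`μ_{∞,m²} ⇒ δ_0` IN LÉVY FORM**: `∫e^{iΣc_jφ(p_j)}dμ_{∞,m²} → 1` as `m² → ∞` — every finite-dimensional marginal of King's block field converges weakly to the point mass at the zero
field (the trivial infrared fixed point). [cite: King1986, Thm 2.1 (2.22)–(2.23) p.654] -/
theorem tendsto_charFun_mass_atTop_kingFieldInf (T : Finset J) (p : J → Fin (d + 1) → ℤ) (c : J → ℝ) :
    Tendsto (fun m2 : ℝ => ∫ ω, Complex.exp (((∑ j ∈ T, c j * ω (p j) : ℝ) : ℂ) * I) ∂kingFieldInf m2) atTop (𝓝 1) := by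
  have hev : (fun m2 : ℝ => Complex.exp (-(((∑ j ∈ T, ∑ j' ∈ T, c j * c j' * kingS2Inf m2 (p j' - p j)) / 2 : ℝ) : ℂ)))
      =ᶠ[atTop] fun m2 : ℝ => ∫ ω, Complex.exp (((∑ j ∈ T, c j * ω (p j) : ℝ) : ℂ) * I) ∂kingFieldInf m2 := by
    filter_upwards [eventually_gt_atTop (0 : ℝ)] with m2 hm2 using (integral_cexp_I_fieldSum hm2 T p c).symm
  refine Tendsto.congr' hev ?_
  have hV := (tendsto_quadForm_mass_atTop T p c).div_const 2
  rw [zero_div] at hV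
  have h := (Complex.continuous_exp.tendsto _).comp ((Complex.continuous_ofReal.tendsto _).comp hV).neg
  rwa [Function.comp_def, Complex.ofReal_zero, neg_zero, Complex.exp_zero] at h

/-- `n ↦ (L²)^n·m² → ∞` for `L ≥ 2`, `m² > 0`. [folklore] -/
theorem tendsto_pow_mul_atTop {m2 : ℝ} (hm : 0 < m2) {L : ℕ} (hL : 2 ≤ L) : Tendsto (fun n : ℕ => ((L : ℝ) ^ 2) ^ n * m2) atTop atTop := by
  have hL2 : (1 : ℝ) < (L : ℝ) ^ 2 := by
    have : (2 : ℝ) ≤ L := by exact_mod_cast hL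
    nlinarith
  exact (tendsto_pow_atTop_atTop_of_one_lt hL2).atTop_mul_const hm

/-- ★★ **ITERATED BLOCK SPINS DRIVE EVERY MASSIVE KING FIELD TO THE TRIVIAL FIXED POINT** (with part Ϻ-dd's `(R_L^n)_*μ_{∞,m²} = μ_{∞,(L²)^nm²}`): for `L ≥ 2`, `m² > 0`,
`∫e^{iΣc_jφ(p_j)}dμ_{∞,(L²)^nm²} → 1` as `n → ∞`. [cite: King1986, §2 (2.3)–(2.6) p.652, Thm 2.1 (2.22) p.654] -/
theorem tendsto_charFun_blockSpin_iterates {m2 : ℝ} (hm : 0 < m2) {L : ℕ} (hL : 2 ≤ L) (T : Finset J) (p : J → Fin (d + 1) → ℤ) (c : J → ℝ) :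
    Tendsto (fun n : ℕ => ∫ ω, Complex.exp (((∑ j ∈ T, c j * ω (p j) : ℝ) : ℂ) * I) ∂kingFieldInf (d := d) (((L : ℝ) ^ 2) ^ n * m2)) atTop (𝓝 1) :=
  (tendsto_charFun_mass_atTop_kingFieldInf T p c).comp (tendsto_pow_mul_atTop hm hL)

end Summit.QuantumFields.YangMills.BalabanUVNodes.N15KingModelRung.InfiniteVolume
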